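import Mathlib
import Literature.Computability.AlgebraicComplexity.BILPS19MinrankClosedProofs
import Literature.Computability.AlgebraicComplexity.BILPS19MinrankInvarianceProofs
import Literature.Computability.AlgebraicComplexity.KV20NonRigidEquationsProofs
import Literature.Computability.AlgebraicComplexity.QuantumFunctionalsDegenerationProofs
import HarnessLib

/-!
# Bläser–Ikenmeyer–Lysikov–Pandey–Schreyer 2019, Cor 20 and Thm 19: the minrank variety is the
# orbit closure of `T_{k,n,r}` (proofs of the named facts `BILPS2019_cor20`, `BILPS2019_thm19`)

Topic `Literature/Computability/AlgebraicComplexity` (val-lit cell, row X5-BILPS19). Theorems only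
(no definitions, no named facts): this file discharges the named facts `BILPS2019_cor20` and
`BILPS2019_thm19` of `Literature/Computability/AlgebraicComplexity/BILPS19MinrankVarieties.lean`
by `BILPS2019_cor20_holds` and `BILPS2019_thm19_holds`.

Source: M. Bläser, C. Ikenmeyer, V. Lysikov, A. Pandey, F.-O. Schreyer, *Variety membership
testing, algebraic natural proofs, and geometric complexity theory*, arXiv:1911.02534
[BlaserIkenmeyerLysikovPandeySchreyer2019], §6.1 (held text `paper:arxiv-1911.02534`, p0023–p0024):
Thm 19 "Let `V` be an `n`-dimensional subspace of `L`. Then `𝓜_{U ⊗ V ⊗ L, r} =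
\overline{(GL_k × GL_s × GL_s) T_{k,n,r}} ∩ (U ⊗ V ⊗ L)`" and Cor 20 "… Suppose `V` and `W` are
subspaces of … `L` of dimension `s = (k-1)n + r`. Then `𝓜_{U ⊗ V ⊗ W, r} = \overline{(GL(U) × GL(L) ×
GL(L)) T_{k,n,r}} ∩ (U ⊗ V ⊗ W)`." PRINTED PROOF (p0023:L92 ff.): `⊇` — `T_{k,n,r} ∈ 𝓜_r`, and `𝓜_r`
is closed (Thm 14) and `GL × GL × GL`-invariant (Lemma 18); `⊆` — for `T ∈ 𝓜_r` pick `x ∈ U^*`,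
`x ≠ 0`, with `rk(Tx) ≤ r`, change the basis of `U` so that `x = e_1^*`; then the first slice has
rank `≤ r` and the other slices have rank `≤ n = dim V`, so `T` is the image of `T_{k,n,r}` under
`(A, B, C)` with `A ∈ GL(U)` and `B, C` ENDOMORPHISMS of `L` built from rank factorisations of the
slices, hence `T` lies in the orbit CLOSURE.

This file FOLLOWS THE PRINTED PROOF over the tree's bricks:

* `⊇`: `BILPS2019Cor20.mem_minrankSet_of_mem_orbitClosure3` from x2 g2's
  `BILPS2019_thm14_holds` (`BILPS19MinrankClosedProofs.lean`) — transported from the typed index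
  sets `Fin k, Fin m, Fin n` to arbitrary finite index types by relabelling
  (`zariskiClosure_image_comp_equiv`, `image_minrankSet_reindex`,
  `zariskiClosure_image_minrankSet`) — and x5's `actTensor_mem_minrankSet`
  (`BILPS19MinrankInvarianceProofs.lean`, Lemma 18); `bilpsTensor_mem_minrankSet` (`T_{k,n,r} ∈ 𝓜_r`:
  its first slice is `E·Eᵀ` for the inclusion `E : F^r → L`).
* `⊆`: `exists_isUnit_row_none_eq` (an invertible `P` with first row `x`),
  `of_slice_eq_sum_inv_smul_contract3` (`T_a = ∑_{a'} (P⁻¹)_{a a'} · T(P_{a'})`),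
  `rank_contract3_le_finrank` (every contraction has its columns in `V`), the rank factorisations
  `KumarVolk2020.exists_mul_eq_of_rank_le` (`KV20NonRigidEquationsProofs.lean`), the block assembly
  `mul_bilpsTensor_none_mul_transpose` / `mul_bilpsTensor_some_mul_transpose` and x5's slice
  formula `actTensor_slice`, giving `exists_actTensor_bilpsTensor_eq :
  T = (A ⊗ B ⊗ C)·T_{k,n,r}`, `A ∈ GL`, `B, C ∈ End`; and the degeneration step
  `trilinearPt_actTensor_mem_orbitClosure3`: `(A ⊗ B ⊗ C)·T₀` lies in the Zariski closure of the
  `GL × GL × GL`-orbit of `T₀` for arbitrary square `B, C` — the one-parameter family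
  `(A, B + t·1, C + t·1)` (characteristic matrices of `-B`, `-C`) stays in the orbit off the
  finitely many roots of the characteristic polynomials, and a polynomial vanishing on the orbit
  then vanishes identically along the family (`eval_zero_mem_zariskiClosure_of_eval_mem`, the
  cofinite variant of the tree's `coeffVec_map_eval_zero_mem_zariskiClosure_of_family`; the field is
  infinite because it is algebraically closed). The printed "hence `T` lies in the orbit closure"
  is exactly this density of `GL(L)` in `End(L)`.

Appendix (`EndDegeneration`): the all-legs version `trilinearPt_actTensor_mem_orbitClosure3_of_end`
(`A, B, C` arbitrary square matrices) and the `End × End × End`-STABILITY of orbit closures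
`trilinearPt_actTensor_mem_orbitClosure3_of_mem` (polynomial tests pull back along the linear
action, `aeval_trilinearPt_actTensor`) — the tensor analogue of the tree's `endOrbit ⊆
orbitClosure` facts for forms, for reuse by the BILPS §6–§8 files.

The typed Cor 20 carries an extra (unused) hypothesis that the `W`-legs lie in some `W ≤ L`; the
hypothesis `dim V = n` is used only through `rk ≤ dim V ≤ n`. Thm 19 is the case `W = L`
(`BILPS2019_thm19_of_cor20`, statement file).

Honest framing: a published half-page proof re-assembled over tree lemmas (val-lit bookkeeping for
the BILPS minrank programme, X5-BILPS19); nothing here bears on `VP ≠ VNP`, which is NOT proved.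

## References

* [BlaserIkenmeyerLysikovPandeySchreyer2019] M. Bläser, C. Ikenmeyer, V. Lysikov, A. Pandey,
  F.-O. Schreyer, arXiv:1911.02534, §6.1: `T_{k,n,r}`, Thm 19, Cor 20 (held text p0023:L80–p0024:L10).
-/

noncomputable section

open MvPolynomial Matrix

namespace Literature.Computability.AlgebraicComplexity

namespace BILPS2019Cor20

/-! ### Zariski closures: one-parameter families off a finite set, and coordinate relabelling -/

section Zariski

variable {k : Type*} [Field k] {ι : Type*}

/-- A point reached at `t = 0` by a polynomial one-parameter family that stays in `S` for all but
finitely many parameters lies in the Zariski closure of `S` (infinite field) — the standard density step behind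
"hence `T` lies in the orbit closure". [cite: BlaserIkenmeyerLysikovPandeySchreyer2019, Cor. 20 (proof)] -/
theorem eval_zero_mem_zariskiClosure_of_eval_mem [Infinite k] (S : Set (ι → k))
    (Φ : ι → Polynomial k) (E : Finset k)
    (hΦ : ∀ t : k, t ∉ E → (fun i => (Φ i).eval t) ∈ S) :
    (fun i => (Φ i).eval 0) ∈ zariskiClosure S := by
  rw [mem_zariskiClosure_iff]
  intro p hp
  set R : Polynomial k := MvPolynomial.aeval Φ p with hR
  have hkey : ∀ t : k, R.eval t = MvPolynomial.aeval (fun i => (Φ i).eval t) p := by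
    intro t
    have h2 : MvPolynomial.aeval (fun i => (Φ i).eval t) p =
        ((Polynomial.aeval t : Polynomial k →ₐ[k] k).comp (MvPolynomial.aeval Φ)) p := by
      simp only [MvPolynomial.comp_aeval, Polynomial.coe_aeval_eq_eval]
    rw [h2, AlgHom.comp_apply, Polynomial.coe_aeval_eq_eval]
  have hroots : Set.Infinite {t : k | R.IsRoot t} := by
    refine Set.Infinite.mono ?_ (E.finite_toSet.infinite_compl)
    intro t ht
    simp only [Set.mem_setOf_eq, Polynomial.IsRoot.def, hkey t]
    exact hp _ (hΦ t ht)
  have hR0 : R = 0 := Polynomial.eq_zero_of_infinite_isRoot R hroots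
  have := hkey 0
  rw [hR0, Polynomial.eval_zero] at this
  exact this.symm

/-- Relabelling coordinates along an equivalence commutes with Zariski closure (used to move Thm 14
between index sets). [cite: BlaserIkenmeyerLysikovPandeySchreyer2019, Thm. 14] -/
theorem zariskiClosure_image_comp_equiv {ι' : Type*} (e : ι' ≃ ι) (S : Set (ι → k)) :
    zariskiClosure ((fun x : ι → k => x ∘ e) '' S) = (fun x : ι → k => x ∘ e) '' zariskiClosure S := by
  ext y
  constructor
  · intro hy
    refine ⟨y ∘ e.symm, ?_, by funext i; simp⟩
    rw [mem_zariskiClosure_iff] at hy ⊢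
    intro q hq
    have h1 := hy (rename e.symm q) (fun x' hx' => by
      obtain ⟨x, hx, rfl⟩ := hx'
      rw [aeval_rename]
      have : ((fun j => x (e j)) ∘ ⇑e.symm) = x := by funext i; simp
      rw [show (x ∘ ⇑e) ∘ ⇑e.symm = x from by funext i; simp]
      exact hq x hx)
    rw [aeval_rename] at h1
    exact h1
  · rintro ⟨z, hz, rfl⟩
    rw [mem_zariskiClosure_iff] at hz ⊢
    intro p hp
    rw [show aeval (z ∘ ⇑e) p = aeval z (rename e p) from by rw [aeval_rename]]
    refine hz _ fun x hx => ?_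
    rw [aeval_rename]
    exact hp _ ⟨x, hx, rfl⟩

end Zariski

/-! ### Relabelling the three index sets of a tensor -/

section Reindex

variable {F : Type*} [Field F] {ι κ μ ι' κ' μ' : Type*}

/-- Contraction of a relabelled tensor. [cite: BlaserIkenmeyerLysikovPandeySchreyer2019, §5 (before Def. 13)] -/
theorem contract3_reindex [Fintype ι] [Fintype ι'] (eι : ι ≃ ι') (eκ : κ ≃ κ') (eμ : μ ≃ μ')
    (T : ι → κ → μ → F) (x' : ι' → F) :
    contract3 (fun a b c => T (eι.symm a) (eκ.symm b) (eμ.symm c)) x' =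
      (contract3 T (x' ∘ eι)).reindex eκ eμ := by
  ext b c
  simp only [contract3_apply, Matrix.reindex_apply, Matrix.submatrix_apply, Function.comp]
  exact Fintype.sum_equiv eι.symm _ _ fun a => by simp

/-- Minrank varieties are stable under relabelling of the index sets.
[cite: BlaserIkenmeyerLysikovPandeySchreyer2019, Def. 15] -/
theorem reindex_mem_minrankSet_iff [Fintype ι] [Fintype ι'] [Fintype κ] [Fintype κ']
    [Fintype μ] [Fintype μ'] (eι : ι ≃ ι') (eκ : κ ≃ κ') (eμ : μ ≃ μ') (r : ℕ)
    (T : ι → κ → μ → F) :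
    (fun a b c => T (eι.symm a) (eκ.symm b) (eμ.symm c)) ∈
        (minrankSet F r : Set (ι' → κ' → μ' → F)) ↔
      T ∈ (minrankSet F r : Set (ι → κ → μ → F)) := by
  constructor
  · rintro ⟨x', hx', hr⟩
    refine ⟨x' ∘ eι, fun h => hx' ?_, ?_⟩
    · funext a
      have := congr_fun h (eι.symm a)
      simpa using this
    · rw [contract3_reindex, Matrix.rank_reindex] at hr
      exact hr
  · rintro ⟨x, hx, hr⟩
    refine ⟨x ∘ eι.symm, fun h => hx ?_, ?_⟩
    · funext a
      have := congr_fun h (eι a)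
      simpa using this
    · rw [contract3_reindex, Matrix.rank_reindex]
      have : ((x ∘ ⇑eι.symm) ∘ ⇑eι) = x := by funext a; simp
      rw [this]
      exact hr

/-- The image of the minrank variety in affine space, after relabelling, is the relabelled image.
[cite: BlaserIkenmeyerLysikovPandeySchreyer2019, Def. 15] -/
theorem image_minrankSet_reindex [Fintype ι] [Fintype ι'] [Fintype κ] [Fintype κ']
    [Fintype μ] [Fintype μ'] (eι : ι ≃ ι') (eκ : κ ≃ κ') (eμ : μ ≃ μ') (r : ℕ) :
    trilinearPt '' (minrankSet F r : Set (ι' → κ' → μ' → F)) =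
      (fun x : ι × κ × μ → F => x ∘ (Equiv.prodCongr eι (Equiv.prodCongr eκ eμ)).symm) ''
        (trilinearPt '' (minrankSet F r : Set (ι → κ → μ → F))) := by
  ext y
  constructor
  · rintro ⟨T', hT', rfl⟩
    refine ⟨trilinearPt (fun a b c => T' (eι a) (eκ b) (eμ c)), ⟨_, ?_, rfl⟩, ?_⟩
    · refine (reindex_mem_minrankSet_iff eι eκ eμ r (fun a b c => T' (eι a) (eκ b) (eμ c))).1 ?_
      have : (fun a b c => (fun a b c => T' (eι a) (eκ b) (eμ c)) (eι.symm a) (eκ.symm b)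
          (eμ.symm c)) = T' := by
        funext a b c; simp
      rw [this]; exact hT'
    · funext p
      simp [trilinearPt]
  · rintro ⟨_, ⟨T, hT, rfl⟩, rfl⟩
    refine ⟨fun a b c => T (eι.symm a) (eκ.symm b) (eμ.symm c),
      (reindex_mem_minrankSet_iff eι eκ eμ r T).2 hT, ?_⟩
    funext p
    simp [trilinearPt]

/-- **Thm 14 for arbitrary finite index types** (from the typed fact `BILPS2019_thm14`, stated on
`Fin k, Fin m, Fin n`, by relabelling). [cite: BlaserIkenmeyerLysikovPandeySchreyer2019, Thm. 14] -/
theorem zariskiClosure_image_minrankSet {F : Type} [Field F] [IsAlgClosed F] {ι κ μ : Type*}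
    [Fintype ι] [Fintype κ] [Fintype μ] (r : ℕ) :
    zariskiClosure (trilinearPt '' (minrankSet F r : Set (ι → κ → μ → F))) =
      trilinearPt '' (minrankSet F r : Set (ι → κ → μ → F)) := by
  have h14 := BILPS2019_thm14_holds F (Fintype.card ι) (Fintype.card κ) (Fintype.card μ) r
  rw [image_minrankSet_reindex (Fintype.equivFin ι).symm (Fintype.equivFin κ).symm
    (Fintype.equivFin μ).symm r, zariskiClosure_image_comp_equiv, h14]

end Reindex

/-! ### From the orbit closure to the minrank variety (Thm 14 + Lemma 18) -/

section Closure

variable {F : Type} [Field F] {ι κ μ : Type*}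
variable [Fintype ι] [Fintype κ] [Fintype μ] [DecidableEq ι] [DecidableEq κ] [DecidableEq μ]

/-- If `T₀ ∈ 𝓜_r` then every tensor whose point lies in the orbit closure of `T₀` is in `𝓜_r`
(`𝓜_r` is closed, Thm 14, and `GL × GL × GL`-invariant, Lemma 18).
[cite: BlaserIkenmeyerLysikovPandeySchreyer2019, Cor. 20 (proof, "⊇")] -/
theorem mem_minrankSet_of_mem_orbitClosure3 [IsAlgClosed F] {r : ℕ} {T₀ T : ι → κ → μ → F}
    (h₀ : T₀ ∈ (minrankSet F r : Set (ι → κ → μ → F)))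
    (h : trilinearPt T ∈ orbitClosure3 T₀) : T ∈ (minrankSet F r : Set (ι → κ → μ → F)) := by
  have hsub : trilinearPt '' glOrbit3 T₀ ⊆ trilinearPt '' (minrankSet F r : Set (ι → κ → μ → F)) := by
    rintro _ ⟨T', ⟨A, B, C, rfl⟩, rfl⟩
    exact ⟨_, actTensor_mem_minrankSet h₀ A B C, rfl⟩
  have h1 : trilinearPt T ∈ trilinearPt '' (minrankSet F r : Set (ι → κ → μ → F)) := by
    rw [← zariskiClosure_image_minrankSet r]
    exact zariskiClosure_mono hsub h
  obtain ⟨T', hT', hTT'⟩ := h1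
  rwa [← trilinearPt_injective hTT']

end Closure

/-! ### The tensor `T_{k,n,r}`: slice formulas and membership in `𝓜_r` -/

section Tensor

variable (F : Type*) [Field F] (k' n r : ℕ)

/-- Entries of `T_{k,n,r}` (unfolding of `bilpsTensor`). [cite: BlaserIkenmeyerLysikovPandeySchreyer2019, §6.1 (definition of T_{k,n,r})] -/
theorem bilpsTensor_none_inl_inl (j j' : Fin r) :
    bilpsTensor F k' n r none (Sum.inl j) (Sum.inl j') = if j = j' then 1 else 0 := rfl

/-- Entries of `T_{k,n,r}` (unfolding of `bilpsTensor`). [cite: BlaserIkenmeyerLysikovPandeySchreyer2019, §6.1 (definition of T_{k,n,r})] -/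
theorem bilpsTensor_none_inl_inr (j : Fin r) (q : Fin n × Fin k') :
    bilpsTensor F k' n r none (Sum.inl j) (Sum.inr q) = 0 := rfl

/-- Entries of `T_{k,n,r}` (unfolding of `bilpsTensor`). [cite: BlaserIkenmeyerLysikovPandeySchreyer2019, §6.1 (definition of T_{k,n,r})] -/
theorem bilpsTensor_none_inr (q : Fin n × Fin k') (c : BIdx k' n r) :
    bilpsTensor F k' n r none (Sum.inr q) c = 0 := by
  cases c <;> rfl

/-- Entries of `T_{k,n,r}` (unfolding of `bilpsTensor`). [cite: BlaserIkenmeyerLysikovPandeySchreyer2019, §6.1 (definition of T_{k,n,r})] -/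
theorem bilpsTensor_some_inl (i : Fin k') (j : Fin r) (c : BIdx k' n r) :
    bilpsTensor F k' n r (some i) (Sum.inl j) c = 0 := by
  cases c <;> rfl

/-- Entries of `T_{k,n,r}` (unfolding of `bilpsTensor`). [cite: BlaserIkenmeyerLysikovPandeySchreyer2019, §6.1 (definition of T_{k,n,r})] -/
theorem bilpsTensor_some_inr_inl (i : Fin k') (q : Fin n × Fin k') (j : Fin r) :
    bilpsTensor F k' n r (some i) (Sum.inr q) (Sum.inl j) = 0 := by
  obtain ⟨a, b⟩ := q
  rfl

/-- Entries of `T_{k,n,r}` (unfolding of `bilpsTensor`). [cite: BlaserIkenmeyerLysikovPandeySchreyer2019, §6.1 (definition of T_{k,n,r})] -/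
theorem bilpsTensor_some_inr_inr (i : Fin k') (j : Fin n) (i₁ : Fin k') (j' : Fin n) (i₂ : Fin k') :
    bilpsTensor F k' n r (some i) (Sum.inr (j, i₁)) (Sum.inr (j', i₂)) =
      if i₁ = i ∧ i₂ = i ∧ j = j' then 1 else 0 := rfl

end Tensor

/-! ### `T_{k,n,r} ∈ 𝓜_r`: its first slice has rank `≤ r` -/

section TensorRank

variable (F : Type*) [Field F] (k' n r : ℕ)

/-- The first slice of `T_{k,n,r}` is the block-diagonal projector onto `L_1 = F^r`, i.e.
`E · Eᵀ` for the inclusion `E : F^r → L`. [cite: BlaserIkenmeyerLysikovPandeySchreyer2019, §6.1 (definition of T_{k,n,r})] -/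
theorem bilpsTensor_none_eq_mul :
    Matrix.of (bilpsTensor F k' n r none) =
      (Matrix.of fun (b : BIdx k' n r) (j : Fin r) => if b = Sum.inl j then (1 : F) else 0) *
        (Matrix.of fun (j : Fin r) (c : BIdx k' n r) => if c = Sum.inl j then (1 : F) else 0) := by
  ext b c
  rw [Matrix.mul_apply]
  rcases b with j₁ | q₁ <;> rcases c with j₂ | q₂
  · simp only [Matrix.of_apply, bilpsTensor_none_inl_inl, Sum.inl.injEq]
    rw [Finset.sum_eq_single j₂]
    · by_cases h : j₁ = j₂ <;> simp [h]
    · intro j _ hj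
      simp [Ne.symm hj]
    · simp
  · simp [bilpsTensor_none_inl_inr]
  · simp [bilpsTensor_none_inr]
  · simp [bilpsTensor_none_inr]

/-- `T_{k,n,r}` lies in the minrank variety `𝓜_r` (contract with `e_1^*`: the slice `I_r ⊕ 0`).
[cite: BlaserIkenmeyerLysikovPandeySchreyer2019, Thm. 19 (proof: "`T_{k,n,r} ∈ 𝓜_r`")] -/
theorem bilpsTensor_mem_minrankSet :
    bilpsTensor F k' n r ∈
      (minrankSet F r : Set (Option (Fin k') → BIdx k' n r → BIdx k' n r → F)) := by
  classical
  refine ⟨fun a => if a = none then 1 else 0, fun h => ?_, ?_⟩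
  · have := congr_fun h none
    simp at this
  · have hc : contract3 (bilpsTensor F k' n r) (fun a => if a = none then 1 else 0) =
        Matrix.of (bilpsTensor F k' n r none) := by
      rw [contract3_eq_sum_smul, Fintype.sum_option]
      simp
    rw [hc, bilpsTensor_none_eq_mul]
    exact (Matrix.rank_mul_le_left _ _).trans
      ((Matrix.rank_le_card_width _).trans (by simp))

end TensorRank

/-! ### Degenerations: the `GL(U) × End(L) × End(L)`-orbit lies in the orbit closure -/

section Degeneration

variable {F : Type*} [Field F] {ι κ μ : Type*}
variable [Fintype ι] [Fintype κ] [Fintype μ] [DecidableEq ι] [DecidableEq κ] [DecidableEq μ]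

omit [DecidableEq ι] [DecidableEq κ] [DecidableEq μ] in
/-- Ring homomorphisms commute with the triple action (entrywise; used for the one-parameter family of
the degeneration step). [cite: BlaserIkenmeyerLysikovPandeySchreyer2019, Cor. 20 (proof)] -/
theorem map_actTensor {R S : Type*} [CommSemiring R] [CommSemiring S] (f : R →+* S)
    (A : Matrix ι ι R) (B : Matrix κ κ R) (C : Matrix μ μ R) (T : ι → κ → μ → R)
    (a : ι) (b : κ) (c : μ) :
    f (actTensor A B C T a b c) =
      actTensor (A.map f) (B.map f) (C.map f) (fun a b c => f (T a b c)) a b c := by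
  simp only [actTensor_apply, map_sum, map_mul, Matrix.map_apply]

/-- The characteristic matrix of `-B` evaluated at `t` is `B + t·1` (the one-parameter family of the
degeneration step). [cite: BlaserIkenmeyerLysikovPandeySchreyer2019, Cor. 20 (proof)] -/
theorem charmatrix_neg_map_eval (B : Matrix κ κ F) (t : F) :
    (Matrix.charmatrix (-B)).map (Polynomial.eval t) = B + t • (1 : Matrix κ κ F) := by
  ext i j
  by_cases h : i = j
  · subst h
    simp [Matrix.charmatrix_apply_eq]
    ring
  · simp [h]

/-- Off the spectrum of `-B`, `B + t·1` is invertible (so the family stays in the `GL`-orbit off a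
finite set). [cite: BlaserIkenmeyerLysikovPandeySchreyer2019, Cor. 20 (proof)] -/
theorem isUnit_add_smul_one_of_not_isRoot (B : Matrix κ κ F) {t : F}
    (ht : ¬ (Matrix.charpoly (-B)).IsRoot t) : IsUnit (B + t • (1 : Matrix κ κ F)) := by
  rw [Matrix.isUnit_iff_isUnit_det, isUnit_iff_ne_zero, ← charmatrix_neg_map_eval]
  have h : ((Matrix.charmatrix (-B)).map (Polynomial.eval t)).det =
      (Matrix.charpoly (-B)).eval t := by
    rw [Matrix.charpoly, ← Polynomial.coe_evalRingHom, RingHom.map_det, RingHom.mapMatrix_apply]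
  rw [h]
  exact ht

/-- **Degenerations lie in the orbit closure**: for `A ∈ GL(U)` and ARBITRARY square matrices
`B, C` (endomorphisms of the other two legs), the point of `(A ⊗ B ⊗ C)·T₀` lies in the Zariski
closure of the `GL × GL × GL`-orbit of `T₀` — via the one-parameter family `(A, B + t·1, C + t·1)`,
which stays in the orbit off the finitely many eigenvalues (infinite field).
[cite: BlaserIkenmeyerLysikovPandeySchreyer2019, Cor. 20 (proof, "⊆": degeneration to the normal form)] -/
theorem trilinearPt_actTensor_mem_orbitClosure3 [Infinite F] (T₀ : ι → κ → μ → F) (A : GL ι F)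
    (B : Matrix κ κ F) (C : Matrix μ μ F) :
    trilinearPt (actTensor (A : Matrix ι ι F) B C T₀) ∈ orbitClosure3 T₀ := by
  classical
  -- the family, as polynomials in `t`
  set Φ : ι × κ × μ → Polynomial F := fun p =>
    actTensor ((A : Matrix ι ι F).map Polynomial.C) (Matrix.charmatrix (-B)) (Matrix.charmatrix (-C))
      (fun a b c => Polynomial.C (T₀ a b c)) p.1 p.2.1 p.2.2 with hΦ
  have hfam : ∀ t : F, (fun p => (Φ p).eval t) =
      trilinearPt (actTensor (A : Matrix ι ι F) (B + t • (1 : Matrix κ κ F))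
        (C + t • (1 : Matrix μ μ F)) T₀) := by
    intro t
    funext p
    simp only [hΦ, trilinearPt]
    rw [← Polynomial.coe_evalRingHom, map_actTensor]
    simp only [Polynomial.coe_evalRingHom, Matrix.map_map, charmatrix_neg_map_eval]
    have hA : (A : Matrix ι ι F).map (Polynomial.eval t ∘ Polynomial.C) = (A : Matrix ι ι F) := by
      ext i j; simp
    have hT : (fun a b c => Polynomial.eval t (Polynomial.C (T₀ a b c))) = T₀ := by
      funext a b c; simp
    rw [hA, hT]
  have h0 := hfam 0
  simp only [zero_smul, add_zero] at h0
  rw [← h0]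
  refine eval_zero_mem_zariskiClosure_of_eval_mem _ Φ
    ((Matrix.charpoly (-B)).roots.toFinset ∪ (Matrix.charpoly (-C)).roots.toFinset) ?_
  intro t ht
  rw [Finset.mem_union, Multiset.mem_toFinset, Multiset.mem_toFinset,
    Polynomial.mem_roots (Matrix.charpoly_monic _).ne_zero,
    Polynomial.mem_roots (Matrix.charpoly_monic _).ne_zero, not_or] at ht
  rw [hfam t]
  refine ⟨_, ⟨A, (isUnit_add_smul_one_of_not_isRoot B ht.1).unit,
    (isUnit_add_smul_one_of_not_isRoot C ht.2).unit, ?_⟩, rfl⟩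
  simp only [IsUnit.unit_spec]

end Degeneration

/-! ### The degeneration `T_{k,n,r} ⇝ T` for `T ∈ 𝓜_r ∩ (U ⊗ V ⊗ L)`, `dim V = n` -/

section Construction

variable {F : Type*} [Field F] {k' n r : ℕ}

/-- Every contraction `Ty` of a tensor whose `V`-legs lie in `V` has rank `≤ dim V` (its columns
lie in `V`). [cite: BlaserIkenmeyerLysikovPandeySchreyer2019, Cor. 20 (proof)] -/
theorem rank_contract3_le_finrank (V : Submodule F (BIdx k' n r → F))
    {T : Option (Fin k') → BIdx k' n r → BIdx k' n r → F} (hTV : ∀ a c, (fun b => T a b c) ∈ V)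
    (y : Option (Fin k') → F) : (contract3 T y).rank ≤ Module.finrank F V := by
  rw [Matrix.rank, Matrix.range_mulVecLin]
  apply Submodule.finrank_mono
  rw [Submodule.span_le]
  rintro _ ⟨c, rfl⟩
  have hcol : (contract3 T y).col c = ∑ a, y a • (fun b => T a b c) := by
    funext b
    show contract3 T y b c = _
    rw [contract3_apply, Finset.sum_apply]
    simp [smul_eq_mul]
  rw [hcol]
  exact V.sum_mem fun a _ => V.smul_mem _ (hTV a c)

/-- A basis change of `U` taking a nonzero `x ∈ U^*` to the first dual basis vector: an invertible
matrix `P` with first row `x` (the other rows are standard basis vectors).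
[cite: BlaserIkenmeyerLysikovPandeySchreyer2019, Cor. 20 (proof)] -/
theorem exists_isUnit_row_none_eq {ι : Type*} [Fintype ι] [DecidableEq ι]
    (x : Option ι → F) (hx : x ≠ 0) :
    ∃ P : Matrix (Option ι) (Option ι) F, IsUnit P ∧ P none = x := by
  classical
  obtain ⟨a₀, ha₀⟩ := Function.ne_iff.1 hx
  let τ : Equiv.Perm (Option ι) := Equiv.swap none a₀
  let P : Matrix (Option ι) (Option ι) F :=
    Matrix.of fun a' a => if a' = none then x a else (if a = τ a' then 1 else 0)
  refine ⟨P, ?_, ?_⟩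
  · rw [← Matrix.mulVec_injective_iff_isUnit]
    intro v w hvw
    -- it suffices to treat `v - w`
    have key : ∀ u : Option ι → F, P.mulVec u = 0 → u = 0 := by
      intro u hu
      have hrow : ∀ a', (P.mulVec u) a' = 0 := fun a' => by rw [hu]; rfl
      have hother : ∀ a, a ≠ a₀ → u a = 0 := by
        intro a ha
        have hτa : τ a ≠ none := by
          intro h
          have : a = τ none := by rw [← h, Equiv.swap_apply_self]
          rw [Equiv.swap_apply_left] at this
          exact ha this
        obtain ⟨i, hi⟩ := Option.ne_none_iff_exists'.1 hτa
        have h1 := hrow (some i)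
        simp only [Matrix.mulVec, dotProduct, P, Matrix.of_apply, reduceCtorEq, if_false] at h1
        rw [Finset.sum_eq_single a] at h1
        · have hτ : τ (some i) = a := by rw [← hi, Equiv.swap_apply_self]
          simpa [hτ] using h1
        · intro b _ hb
          have hτ : τ (some i) = a := by rw [← hi, Equiv.swap_apply_self]
          rw [hτ, if_neg hb, zero_mul]
        · simp
      have h0 := hrow none
      simp only [Matrix.mulVec, dotProduct, P, Matrix.of_apply, if_true] at h0
      rw [Finset.sum_eq_single a₀] at h0
      · have : u a₀ = 0 := by
          rcases mul_eq_zero.1 h0 with h | h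
          · exact absurd h ha₀
          · exact h
        funext a
        by_cases ha : a = a₀
        · rw [ha, this]; rfl
        · rw [hother a ha]; rfl
      · intro b _ hb
        rw [hother b hb, mul_zero]
      · simp
    have : v - w = 0 := key (v - w) (by rw [Matrix.mulVec_sub, hvw, sub_self])
    exact sub_eq_zero.1 this
  · funext a
    simp [P]

/-- **Slices through a basis change**: for an invertible `P`, every slice `T_a` is the combination
`∑_{a'} (P⁻¹)_{a a'} · T(P_{a'})` of the contractions with the rows of `P`.
[cite: BlaserIkenmeyerLysikovPandeySchreyer2019, Cor. 20 (proof)] -/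
theorem of_slice_eq_sum_inv_smul_contract3 {ι κ μ : Type*} [Fintype ι] [DecidableEq ι]
    (T : ι → κ → μ → F) (P : Matrix ι ι F) (hP : IsUnit P) (a : ι) :
    Matrix.of (T a) = ∑ a', P⁻¹ a a' • contract3 T (P a') := by
  have hinv : P⁻¹ * P = 1 := Matrix.nonsing_inv_mul P ((Matrix.isUnit_iff_isUnit_det P).1 hP)
  simp_rw [contract3_eq_sum_smul, Finset.smul_sum, smul_smul]
  rw [Finset.sum_comm]
  simp_rw [← Finset.sum_smul]
  have h : ∀ a'', (∑ a', P⁻¹ a a' * P a' a'') = (1 : Matrix ι ι F) a a'' := fun a'' => by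
    rw [← hinv, Matrix.mul_apply]
  simp_rw [h, Matrix.one_apply, ite_smul, one_smul, zero_smul, Finset.sum_ite_eq, Finset.mem_univ,
    if_true]

/-- The product `B · (T_{k,n,r})_{e_1} · Cᵀ` only sees the `L_1`-columns of `B` and `C`.
[cite: BlaserIkenmeyerLysikovPandeySchreyer2019, §6.1 (definition of T_{k,n,r})] -/
theorem mul_bilpsTensor_none_mul_transpose (B C : Matrix (BIdx k' n r) (BIdx k' n r) F) :
    B * Matrix.of (bilpsTensor F k' n r none) * Cᵀ =
      (Matrix.of fun b (j : Fin r) => B b (Sum.inl j)) * Matrix.of fun (j : Fin r) c => C c (Sum.inl j) := by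
  ext b c
  have hBM : ∀ c₁, (B * Matrix.of (bilpsTensor F k' n r none)) b c₁ =
      Sum.elim (fun j' => B b (Sum.inl j')) (fun _ => 0) c₁ := by
    intro c₁
    rw [Matrix.mul_apply, Fintype.sum_sum_type]
    rcases c₁ with j' | q'
    · simp only [Matrix.of_apply, bilpsTensor_none_inl_inl, bilpsTensor_none_inr, mul_zero,
        Finset.sum_const_zero, add_zero, Sum.elim_inl, mul_ite, mul_one, Finset.sum_ite_eq',
        Finset.mem_univ, if_true]
    · simp [Matrix.of_apply, bilpsTensor_none_inl_inr, bilpsTensor_none_inr]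
  rw [Matrix.mul_apply, Matrix.mul_apply, Fintype.sum_sum_type]
  simp [hBM, Matrix.transpose_apply, Matrix.of_apply]

/-- The product `B · (T_{k,n,r})_{e_{i+2}} · Cᵀ` only sees the `L_{i+2}`-columns of `B` and `C`.
[cite: BlaserIkenmeyerLysikovPandeySchreyer2019, §6.1 (definition of T_{k,n,r})] -/
theorem mul_bilpsTensor_some_mul_transpose (B C : Matrix (BIdx k' n r) (BIdx k' n r) F)
    (i : Fin k') :
    B * Matrix.of (bilpsTensor F k' n r (some i)) * Cᵀ =
      (Matrix.of fun b (j : Fin n) => B b (Sum.inr (j, i))) *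
        Matrix.of fun (j : Fin n) c => C c (Sum.inr (j, i)) := by
  ext b c
  have hBM : ∀ c₁, (B * Matrix.of (bilpsTensor F k' n r (some i))) b c₁ =
      Sum.elim (fun _ => 0) (fun q => if q.2 = i then B b (Sum.inr (q.1, i)) else 0) c₁ := by
    intro c₁
    rw [Matrix.mul_apply, Fintype.sum_sum_type]
    rcases c₁ with j' | ⟨j', i₂⟩
    · simp [Matrix.of_apply, bilpsTensor_some_inl, bilpsTensor_some_inr_inl]
    · simp only [Matrix.of_apply, bilpsTensor_some_inl, mul_zero, Finset.sum_const_zero, zero_add,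
        Sum.elim_inr]
      rw [Fintype.sum_prod_type]
      simp only [bilpsTensor_some_inr_inr]
      by_cases hi : i₂ = i
      · subst hi
        simp only [true_and, if_true]
        rw [Finset.sum_eq_single j']
        · rw [Finset.sum_eq_single i₂]
          · simp
          · intro i₁ _ h1; simp [h1]
          · simp
        · intro j _ hj; refine Finset.sum_eq_zero fun i₁ _ => ?_; simp [hj]
        · simp
      · rw [if_neg hi]
        refine Finset.sum_eq_zero fun j _ => Finset.sum_eq_zero fun i₁ _ => ?_
        simp [hi]
  rw [Matrix.mul_apply, Matrix.mul_apply, Fintype.sum_sum_type, Fintype.sum_prod_type]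
  simp only [hBM, Sum.elim_inl, zero_mul, Finset.sum_const_zero, zero_add, Sum.elim_inr,
    Matrix.transpose_apply, Matrix.of_apply, ite_mul, zero_mul]
  rw [Finset.sum_comm]
  rw [Finset.sum_eq_single i]
  · simp
  · intro i₂ _ h2; simp [h2]
  · simp

/-- **The degeneration** (printed proof of Cor 20): a tensor `T ∈ 𝓜_r` whose `V`-legs lie in an
`n`-dimensional `V ≤ L` equals `(A ⊗ B ⊗ C) · T_{k,n,r}` for some `A ∈ GL(U)` and ENDOMORPHISMS
`B, C` of `L` (change the basis of `U` so that `x = e_1^*`; rank-factor the slices: the first through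
`F^r`, the others through `F^n`). [cite: BlaserIkenmeyerLysikovPandeySchreyer2019, Cor. 20 (proof)] -/
theorem exists_actTensor_bilpsTensor_eq (V : Submodule F (BIdx k' n r → F))
    (hV : Module.finrank F V = n) (T : Option (Fin k') → BIdx k' n r → BIdx k' n r → F)
    (hTV : ∀ a c, (fun b => T a b c) ∈ V)
    (hT : T ∈ (minrankSet F r : Set (Option (Fin k') → BIdx k' n r → BIdx k' n r → F))) :
    ∃ (A : GL (Option (Fin k')) F) (B C : Matrix (BIdx k' n r) (BIdx k' n r) F),
      actTensor (A : Matrix (Option (Fin k')) (Option (Fin k')) F) B C (bilpsTensor F k' n r) = T := by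
  classical
  obtain ⟨x, hx, hr⟩ := hT
  obtain ⟨P, hP, hPx⟩ := exists_isUnit_row_none_eq x hx
  -- rank factorisations of the contracted slices
  have hr0 : (contract3 T (P none)).rank ≤ r := by rw [hPx]; exact hr
  have hrn : ∀ i : Fin k', (contract3 T (P (some i))).rank ≤ n := fun i =>
    (rank_contract3_le_finrank V hTV _).trans hV.le
  obtain ⟨B₀, C₀, h₀⟩ := KumarVolk2020.exists_mul_eq_of_rank_le (contract3 T (P none)) hr0
  choose Bs Cs hs using fun i => KumarVolk2020.exists_mul_eq_of_rank_le (contract3 T (P (some i))) (hrn i)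
  -- assemble the endomorphisms blockwise
  let B : Matrix (BIdx k' n r) (BIdx k' n r) F :=
    Matrix.of fun b c => Sum.elim (fun j => B₀ b j) (fun q => Bs q.2 b q.1) c
  let C : Matrix (BIdx k' n r) (BIdx k' n r) F :=
    Matrix.of fun c c₁ => Sum.elim (fun j => C₀ j c) (fun q => Cs q.2 q.1 c) c₁
  have hBnone : B * Matrix.of (bilpsTensor F k' n r none) * Cᵀ = contract3 T (P none) := by
    rw [mul_bilpsTensor_none_mul_transpose, ← h₀]
    rfl
  have hBsome : ∀ i, B * Matrix.of (bilpsTensor F k' n r (some i)) * Cᵀ = contract3 T (P (some i)) := by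
    intro i
    rw [mul_bilpsTensor_some_mul_transpose, ← hs i]
    rfl
  refine ⟨hP.unit⁻¹, B, C, ?_⟩
  funext a
  apply Matrix.of.injective
  rw [actTensor_slice, of_slice_eq_sum_inv_smul_contract3 T P hP a, Fintype.sum_option,
    Fintype.sum_option, hBnone]
  simp only [hBsome]
  have hcoe : ((hP.unit⁻¹ : GL (Option (Fin k')) F) : Matrix (Option (Fin k')) (Option (Fin k')) F) = P⁻¹ := by
    rw [Matrix.coe_units_inv, IsUnit.unit_spec]
  rw [hcoe]

end Construction


end BILPS2019Cor20

/-! ### BILPS Cor 20 and Thm 19, discharged -/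

/-- **BILPS Cor 20, discharged** (`𝓜_r ∩ (U ⊗ V ⊗ W) = closure((GL × GL × GL)·T_{k,n,r}) ∩ (U ⊗ V ⊗ W)`,
typed membership form). [cite: BlaserIkenmeyerLysikovPandeySchreyer2019, Cor. 20] -/
theorem BILPS2019_cor20_holds : BILPS2019_cor20 := by
  intro F _ _ k' n r V W hV T hTV _
  constructor
  · intro hT
    obtain ⟨A, B, C, h⟩ := BILPS2019Cor20.exists_actTensor_bilpsTensor_eq V hV T hTV hT
    rw [← h]
    exact BILPS2019Cor20.trilinearPt_actTensor_mem_orbitClosure3 _ A B C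
  · intro h
    exact BILPS2019Cor20.mem_minrankSet_of_mem_orbitClosure3
      (BILPS2019Cor20.bilpsTensor_mem_minrankSet F k' n r) h

/-- **BILPS Thm 19, discharged** (the case `W = L` of Cor 20, by the tree's
`BILPS2019_thm19_of_cor20`). [cite: BlaserIkenmeyerLysikovPandeySchreyer2019, Thm. 19] -/
theorem BILPS2019_thm19_holds : BILPS2019_thm19 :=
  BILPS2019_thm19_of_cor20 BILPS2019_cor20_holds

/-! ### Appendix: `End × End × End`-degenerations and the `End³`-stability of orbit closures -/

namespace BILPS2019Cor20

section EndDegeneration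

variable {F : Type*} [Field F] {ι κ μ : Type*}
variable [Fintype ι] [Fintype κ] [Fintype μ] [DecidableEq ι] [DecidableEq κ] [DecidableEq μ]

/-- **All-legs version of the degeneration step**: for ARBITRARY square matrices `A, B, C` the point
of `(A ⊗ B ⊗ C)·T₀` lies in the Zariski closure of the `GL × GL × GL`-orbit of `T₀` (one-parameter
family `(A + t·1, B + t·1, C + t·1)`, invertible off the roots of the three characteristic
polynomials; infinite field). [cite: BlaserIkenmeyerLysikovPandeySchreyer2019, Cor. 20 (proof: degenerations lie in the orbit closure)] -/
theorem trilinearPt_actTensor_mem_orbitClosure3_of_end [Infinite F] (T₀ : ι → κ → μ → F)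
    (A : Matrix ι ι F) (B : Matrix κ κ F) (C : Matrix μ μ F) :
    trilinearPt (actTensor A B C T₀) ∈ orbitClosure3 T₀ := by
  classical
  set Φ : ι × κ × μ → Polynomial F := fun p =>
    actTensor (Matrix.charmatrix (-A)) (Matrix.charmatrix (-B)) (Matrix.charmatrix (-C))
      (fun a b c => Polynomial.C (T₀ a b c)) p.1 p.2.1 p.2.2 with hΦ
  have hfam : ∀ t : F, (fun p => (Φ p).eval t) =
      trilinearPt (actTensor (A + t • (1 : Matrix ι ι F)) (B + t • (1 : Matrix κ κ F))
        (C + t • (1 : Matrix μ μ F)) T₀) := by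
    intro t
    funext p
    simp only [hΦ, trilinearPt]
    rw [← Polynomial.coe_evalRingHom, map_actTensor]
    simp only [Polynomial.coe_evalRingHom, charmatrix_neg_map_eval]
    have hT : (fun a b c => Polynomial.eval t (Polynomial.C (T₀ a b c))) = T₀ := by
      funext a b c; simp
    rw [hT]
  have h0 := hfam 0
  simp only [zero_smul, add_zero] at h0
  rw [← h0]
  refine eval_zero_mem_zariskiClosure_of_eval_mem _ Φ
    ((Matrix.charpoly (-A)).roots.toFinset ∪ (Matrix.charpoly (-B)).roots.toFinset ∪
      (Matrix.charpoly (-C)).roots.toFinset) ?_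
  intro t ht
  rw [Finset.mem_union, Finset.mem_union, Multiset.mem_toFinset, Multiset.mem_toFinset,
    Multiset.mem_toFinset, Polynomial.mem_roots (Matrix.charpoly_monic _).ne_zero,
    Polynomial.mem_roots (Matrix.charpoly_monic _).ne_zero,
    Polynomial.mem_roots (Matrix.charpoly_monic _).ne_zero, not_or, not_or] at ht
  rw [hfam t]
  refine ⟨_, ⟨(isUnit_add_smul_one_of_not_isRoot A ht.1.1).unit,
    (isUnit_add_smul_one_of_not_isRoot B ht.1.2).unit,
    (isUnit_add_smul_one_of_not_isRoot C ht.2).unit, ?_⟩, rfl⟩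
  simp only [IsUnit.unit_spec]

omit [DecidableEq ι] [DecidableEq κ] [DecidableEq μ] in
/-- The triple action on coordinates is the evaluation of linear forms: a polynomial test on
`(A ⊗ B ⊗ C)·T` is a polynomial test on `T`. [cite: BlaserIkenmeyerLysikovPandeySchreyer2019, §1.1 (the standard action on U ⊗ V ⊗ W)] -/
theorem aeval_trilinearPt_actTensor (A : Matrix ι ι F) (B : Matrix κ κ F) (C : Matrix μ μ F)
    (T : ι → κ → μ → F) (p : MvPolynomial (ι × κ × μ) F) :
    aeval (trilinearPt (actTensor A B C T)) p =
      aeval (trilinearPt T)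
        (aeval (fun q : ι × κ × μ => ∑ a', ∑ b', ∑ c',
          MvPolynomial.C (A q.1 a' * B q.2.1 b' * C q.2.2 c') * X (a', b', c')) p) := by
  have hfun : trilinearPt (actTensor A B C T) = fun q : ι × κ × μ =>
      aeval (trilinearPt T) (∑ a', ∑ b', ∑ c',
        MvPolynomial.C (A q.1 a' * B q.2.1 b' * C q.2.2 c') * X (a', b', c')) := by
    funext q
    simp only [trilinearPt, actTensor_apply, map_sum, map_mul, aeval_C, aeval_X,
      Algebra.algebraMap_self, RingHom.id_apply]
  rw [← AlgHom.comp_apply, MvPolynomial.comp_aeval, hfun]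

/-- **Orbit closures are stable under `End × End × End`**: if the point of `T` lies in the orbit
closure of `T₀`, so does the point of `(A ⊗ B ⊗ C)·T` for arbitrary square `A, B, C` (polynomial
tests pull back along the linear action; degenerations of orbit points lie in the closure).
[cite: BlaserIkenmeyerLysikovPandeySchreyer2019, Cor. 20 (proof: degenerations lie in the orbit closure)] -/
theorem trilinearPt_actTensor_mem_orbitClosure3_of_mem [Infinite F] {T₀ T : ι → κ → μ → F}
    (h : trilinearPt T ∈ orbitClosure3 T₀) (A : Matrix ι ι F) (B : Matrix κ κ F)
    (C : Matrix μ μ F) : trilinearPt (actTensor A B C T) ∈ orbitClosure3 T₀ := by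
  classical
  rw [orbitClosure3, mem_zariskiClosure_iff] at h ⊢
  intro p hp
  rw [aeval_trilinearPt_actTensor]
  refine h _ fun y hy => ?_
  obtain ⟨T', ⟨gA, gB, gC, rfl⟩, rfl⟩ := hy
  rw [← aeval_trilinearPt_actTensor, actTensor_actTensor]
  -- `(A·gA ⊗ B·gB ⊗ C·gC)·T₀` is an `End³`-degeneration, hence in the closure, where `p` vanishes
  have hmem := trilinearPt_actTensor_mem_orbitClosure3_of_end T₀ (A * (gA : Matrix ι ι F))
    (B * (gB : Matrix κ κ F)) (C * (gC : Matrix μ μ F))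
  rw [orbitClosure3, mem_zariskiClosure_iff] at hmem
  exact hmem p hp

end EndDegeneration

end BILPS2019Cor20

end Literature.Computability.AlgebraicComplexity
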